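import Summits.CriticalPhenomena.PercolationContinuityZ3.Theorems.PercNearOneGluingNoHeavyLowerTailSunflowerMultiPetalKempePinnedClasses
import HarnessLib
import HarnessLib.Audit

/-!
# `NoHeavyLowerTail` (crux stmt-CriticalPhenomena-4575), Lemma B for graph clutters: the TWO-TERMINAL INEQUALITY (C) in colouring
# language, its link to the pinned one-point classes, and the SWAP LEMMA B1 (the `−2` part of (C), proved)

Support file (seat `prim-l12-p2` gen 41; `--supports stmt-CriticalPhenomena-4575`; continuation of `…SunflowerMultiPetalKempePinnedClasses`
(p416077: `fC2`, `bprof`, `pinned_sum_ge_twoTerminal`) and `…KempePinned` (p414773)).  No `sorry`; nothing is asserted about the crux; the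
`@[conjecture]` definition is an obligation of the programme, never a fact.
Memo: run/shared/lean/prim/prim-l12/prim-l12-p2/FINDING-g41-TWO-TERMINAL-REDUCTION.md §1–§3.

TWO-TERMINAL CELLS.  For terminals `u ≠ v` the cells are the colourings with `σ u = 0`, `σ v = 1`; `tcell G u v t` counts those of capped type
`t`, and the two-terminal functional is `Tfun G u v = Σ_t fC t · tcell t` (`fC = [100]+[010]+2[200]+2[020]−2[001]−[101]−[011]`, p414773).
By the memo's THEOREM R (exact identities; its pointwise and class-level halves are p414773/p416077), Lemma B for all marked multigraphs
follows from `Tfun ≥ 0` on connected marked multigraphs; this file records the SIMPLE-GRAPH case as the typed obligation `TwoTerminalC`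
(census: 0 failures over every simple graph on ≤ 9 vertices and every pair — 10.2 M instances, kit j247600/j247866 — and over 2.0 G marked /
multi-edge instances on ≤ 8 vertices; connected slack ≥ 1.9), shows that it is EXACTLY the pinned class of a degree-two vertex with differently
coloured neighbours (`pinned_sum_eq_Tfun`: the class sum of `PinnedMZ` at such an `x` is `Tfun (G − x) u v`), and PROVES the swap lemma
B1 (`tcell_001_le`): the global colour swap `0 ↔ 2` off the terminal `u` (`phiU`) maps every `−2` cell (type `(0,0,1)`: a single monochromatic
edge, of the third colour) injectively to a credit cell (type `(1,0,0)` or `(2,0,0)`), so `N[001] ≤ N[100] + N[200]` — with its mirror image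
this covers the `−2·N[001]` term of (C) (memo §3a).
-/

namespace Summit.CriticalPhenomena.PercolationContinuityZ3.Theorems.SunflowerPartition.Kempe

open Finset
open scoped Classical

/-! ## The swap `0 ↔ 2` -/

/-- Swap of the colours `0` and `2`. [this work] -/
def sw02 (c : Fin 3) : Fin 3 := if c = 0 then 2 else if c = 2 then 0 else c

/-- `sw02` is an involution. [this work] -/
theorem sw02_sw02 : ∀ c, sw02 (sw02 c) = c := by decide

/-- Value table facts of `sw02`. [this work] -/
theorem sw02_eq_one_iff : ∀ c, sw02 c = 1 ↔ c = 1 := by decide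

/-- `sw02 c = 2 ↔ c = 0`. [this work] -/
theorem sw02_eq_two_iff : ∀ c, sw02 c = 2 ↔ c = 0 := by decide

/-- `sw02 2 = 0`. [this work] -/
theorem sw02_two : sw02 2 = 0 := by decide

section TwoTerminal

variable {V : Type*} [Fintype V] (G : SimpleGraph V) (u v : V)

/-! ## Two-terminal cells and the functional -/

/-- `tcell G u v t`: the number of colourings with `σ u = 0`, `σ v = 1` and capped type `t`. [this work] -/
noncomputable def tcell (t : CType) : ℕ := (univ.filter fun σ : V → Fin 3 => σ u = 0 ∧ σ v = 1 ∧ ctype G σ = t).card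

/-- The TWO-TERMINAL FUNCTIONAL `Tfun G u v = Σ_t fC t · tcell t` (= `T(K;u,v)/6` of the memo for the simple graph `K = G`). [this work] -/
noncomputable def Tfun : ℤ := ∑ t : CType, fC t * (tcell G u v t : ℤ)

/-- `Tfun` as a sum over the cells. [this work] -/
theorem Tfun_eq_sum : Tfun G u v = ∑ σ ∈ univ.filter (fun σ : V → Fin 3 => σ u = 0 ∧ σ v = 1), fC (ctype G σ) := by
  unfold Tfun tcell
  rw [← sum_fiberwise_of_maps_to (s := univ.filter fun σ : V → Fin 3 => σ u = 0 ∧ σ v = 1) (t := (univ : Finset CType))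
    (g := fun σ => ctype G σ) (fun _ _ => mem_univ _)]
  refine sum_congr rfl fun t _ => ?_
  have hs : (univ.filter fun σ : V → Fin 3 => σ u = 0 ∧ σ v = 1 ∧ ctype G σ = t)
      = (univ.filter fun σ : V → Fin 3 => σ u = 0 ∧ σ v = 1).filter (fun σ => ctype G σ = t) := by
    ext σ; simp only [mem_filter, mem_univ, true_and, and_assoc]
  rw [hs, sum_congr rfl fun σ hσ => by rw [(mem_filter.1 hσ).2], sum_const, nsmul_eq_mul, mul_comm]

end TwoTerminal

/-- **THE TWO-TERMINAL INEQUALITY (C), SIMPLE-GRAPH CASE** (this work; OPEN; exact enumeration: 0 failures over all simple graphs on ≤ 9 vertices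
and all pairs `u ≠ v` — connected or not, 10.2 M instances, tight only on disconnected graphs, connected slack ≥ 1.9 — and over 2.0 G
marked/multi-edge instances on ≤ 8 vertices): for a connected finite graph and two vertices `u ≠ v`, `Tfun G u v ≥ 0`.  By the memo's
THEOREM R the marked-multigraph version of this inequality implies Lemma B for every graph clutter; `pinned_sum_eq_Tfun` below identifies it
with the degree-two class of `PinnedMZ`.  An obligation, never a fact: use as `(h : TwoTerminalC)`. [status: open] -/
@[conjecture] def TwoTerminalC : Prop :=
  ∀ (V : Type) [Fintype V] (G : SimpleGraph V) (u v : V), u ≠ v → G.Connected → 0 ≤ Tfun G u v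

section Link

variable {V : Type*} [Fintype V] (G : SimpleGraph V) (x : V)

/-- **THE DEGREE-TWO PINNED CLASS IS THE TWO-TERMINAL FUNCTIONAL**: if `x` has exactly the two neighbours `u ≠ v` and the boundary colouring
gives them the colours `0` and `1`, the pinned class sum of the one-point kernel is `Tfun (G − x) u v` (for `u = v` the hypotheses are
contradictory and the statement is vacuous). [this work] -/
theorem pinned_sum_eq_Tfun (κ : V → Fin 3) (u v : ({x}ᶜ : Set V))
    (hN : ∀ w : V, G.Adj x w ↔ (w = u.1 ∨ w = v.1)) (hu : κ u.1 = 0) (hv : κ v.1 = 1) :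
    ∑ τ ∈ pinnedClass G x κ, kerMZ G x τ = Tfun (G.induce ({x}ᶜ : Set V)) u v := by
  have hxu : G.Adj x u.1 := (hN u.1).2 (Or.inl rfl)
  have hxv : G.Adj x v.1 := (hN v.1).2 (Or.inr rfl)
  have hcls : pinnedClass G x κ = univ.filter fun τ : (({x}ᶜ : Set V)) → Fin 3 => τ u = 0 ∧ τ v = 1 := by
    ext τ
    simp only [pinnedClass, mem_filter, mem_univ, true_and]
    constructor
    · intro h; exact ⟨hu ▸ h u hxu, hv ▸ h v hxv⟩
    · rintro ⟨h0, h1⟩ w hw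
      rcases (hN w.1).1 hw with h | h
      · rw [Subtype.ext h, h0, hu]
      · rw [Subtype.ext h, h1, hv]
  have hb : ∀ c, bprof G x κ c = (if c = 0 then 1 else 0) + (if c = 1 then 1 else 0) := by
    intro c
    unfold bprof
    have hset : (univ.filter fun w : V => G.Adj x w ∧ κ w = c) = ({u.1, v.1} : Finset V).filter fun w => κ w = c := by
      ext w; simp only [mem_filter, mem_univ, true_and, mem_insert, mem_singleton, hN w]
    rw [hset, filter_insert, filter_singleton, hu, hv]
    by_cases h0 : c = 0
    · subst h0; simp
    · by_cases h1 : c = 1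
      · subst h1; simp
      · rw [if_neg (Ne.symm h0), if_neg (Ne.symm h1), if_neg h0, if_neg h1]; rfl
  have hprof : bprof3 G x κ = (1, 1, 0) := by
    unfold bprof3; rw [hb 0, hb 1, hb 2]; rfl
  rw [Tfun_eq_sum]
  refine sum_congr ?_ fun τ hτ => ?_
  · ext τ
    simp only [hcls, mem_filter, mem_univ, true_and]
  · have hτ' : τ ∈ pinnedClass G x κ := by
      rw [hcls]
      simp only [mem_filter, mem_univ, true_and] at hτ ⊢
      exact hτ
    rw [kerMZ_eq_of_mem G x hτ', hprof, kerAbs_one_one]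

end Link

/-- Consequently, under `TwoTerminalC` the degree-two two-coloured classes of `PinnedMZ` are nonnegative whenever `G − x` is connected. [this work] -/
theorem pinned_sum_nonneg_of_twoTerminalC (h : TwoTerminalC) {V : Type} [Fintype V] (G : SimpleGraph V) (x : V)
    (hx : (G.induce ({x}ᶜ : Set V)).Connected) (κ : V → Fin 3) (u v : ({x}ᶜ : Set V)) (huv : u ≠ v)
    (hN : ∀ w : V, G.Adj x w ↔ (w = u.1 ∨ w = v.1)) (hu : κ u.1 = 0) (hv : κ v.1 = 1) :
    0 ≤ ∑ τ ∈ pinnedClass G x κ, kerMZ G x τ := by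
  rw [pinned_sum_eq_Tfun G x κ u v hN hu hv]
  exact h _ _ u v huv hx

section Swap

variable {V : Type*} [Fintype V] (G : SimpleGraph V) (u v : V)

/-! ## The swap lemma B1 -/

/-- The GLOBAL SWAP `Φ_u`: exchange the colours `0 ↔ 2` at every vertex except the terminal `u`. [this work] -/
noncomputable def phiU (σ : V → Fin 3) : V → Fin 3 := fun w => if w = u then σ w else sw02 (σ w)

omit [Fintype V] in
/-- `Φ_u` is an involution. [this work] -/
theorem phiU_phiU (σ : V → Fin 3) : phiU u (phiU u σ) = σ := by
  funext w
  unfold phiU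
  split_ifs with h
  · rfl
  · exact sw02_sw02 _

omit [Fintype V] in
/-- `Φ_u` away from `u`. [this work] -/
theorem phiU_of_ne (σ : V → Fin 3) {w : V} (hw : w ≠ u) : phiU u σ w = sw02 (σ w) := by
  unfold phiU; rw [if_neg hw]

omit [Fintype V] in
/-- `Φ_u` at `u`. [this work] -/
theorem phiU_self (σ : V → Fin 3) : phiU u σ u = σ u := by
  unfold phiU; rw [if_pos rfl]

/-- A monochromatic edge of colour `c ≠ σ u` avoids `u`. [this work] -/
theorem ne_of_mem_monoCol {σ : V → Fin 3} {c : Fin 3} {p q : V} (h : s(p, q) ∈ monoCol G σ c) (hc : σ u ≠ c) : p ≠ u ∧ q ≠ u := by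
  rw [mk_mem_monoCol_iff] at h
  exact ⟨fun hp => hc (hp ▸ h.2.1), fun hq => hc (hq ▸ h.2.2)⟩

/-- If `σ u = 0` and `σ` has no monochromatic edge of colour `1`, neither has `Φ_u σ`. [this work] -/
theorem cnt_phiU_one {σ : V → Fin 3} (hu : σ u = 0) (h1 : cnt G σ 1 = 0) : cnt G (phiU u σ) 1 = 0 := by
  unfold cnt at h1 ⊢
  rw [card_eq_zero] at h1 ⊢
  rw [eq_empty_iff_forall_notMem] at h1 ⊢
  intro e he
  induction e using Sym2.ind with
  | _ p q =>
    have hu' : phiU u σ u ≠ 1 := by rw [phiU_self, hu]; decide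
    obtain ⟨hp, hq⟩ := ne_of_mem_monoCol G u he hu'
    rw [mk_mem_monoCol_iff, phiU_of_ne u σ hp, phiU_of_ne u σ hq, sw02_eq_one_iff, sw02_eq_one_iff] at he
    exact h1 s(p, q) ((mk_mem_monoCol_iff G σ 1 p q).2 he)

/-- If `σ u = 0` and `σ` has no monochromatic edge of colour `0`, then `Φ_u σ` has none of colour `2`. [this work] -/
theorem cnt_phiU_two {σ : V → Fin 3} (hu : σ u = 0) (h0 : cnt G σ 0 = 0) : cnt G (phiU u σ) 2 = 0 := by
  unfold cnt at h0 ⊢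
  rw [card_eq_zero] at h0 ⊢
  rw [eq_empty_iff_forall_notMem] at h0 ⊢
  intro e he
  induction e using Sym2.ind with
  | _ p q =>
    have hu' : phiU u σ u ≠ 2 := by rw [phiU_self, hu]; decide
    obtain ⟨hp, hq⟩ := ne_of_mem_monoCol G u he hu'
    rw [mk_mem_monoCol_iff, phiU_of_ne u σ hp, phiU_of_ne u σ hq, sw02_eq_two_iff, sw02_eq_two_iff] at he
    exact h0 s(p, q) ((mk_mem_monoCol_iff G σ 0 p q).2 he)

/-- If `σ u = 0` and `σ` has a monochromatic edge of colour `2`, then `Φ_u σ` has one of colour `0`. [this work] -/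
theorem cnt_phiU_zero_pos {σ : V → Fin 3} (hu : σ u = 0) (h2 : cnt G σ 2 ≠ 0) : cnt G (phiU u σ) 0 ≠ 0 := by
  unfold cnt at h2 ⊢
  rw [Ne, card_eq_zero, ← Ne, ← nonempty_iff_ne_empty] at h2 ⊢
  obtain ⟨e, he⟩ := h2
  induction e using Sym2.ind with
  | _ p q =>
    have hu' : σ u ≠ 2 := by rw [hu]; decide
    obtain ⟨hp, hq⟩ := ne_of_mem_monoCol G u he hu'
    rw [mk_mem_monoCol_iff] at he
    refine ⟨s(p, q), (mk_mem_monoCol_iff G _ 0 p q).2 ⟨he.1, ?_, ?_⟩⟩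
    · rw [phiU_of_ne u σ hp, he.2.1, sw02_two]
    · rw [phiU_of_ne u σ hq, he.2.2, sw02_two]

/-- **LEMMA B1 (the swap lemma)**: `N[001] ≤ N[100] + N[200]` — every colouring with `σ u = 0`, `σ v = 1` whose monochromatic set is a single
edge of the third colour is mapped by `Φ_u` injectively to a colouring whose monochromatic edges are nonempty and all of colour `0`
(memo §3a; with its mirror image this proves the `−2·N[001]` part of the two-terminal inequality (C)). [this work] -/
theorem tcell_001_le (huv : u ≠ v) : tcell G u v (0, 0, 1) ≤ tcell G u v (1, 0, 0) + tcell G u v (2, 0, 0) := by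
  unfold tcell
  rw [← card_union_of_disjoint (disjoint_filter.2 fun σ _ h1 h2 => by
    rw [h1.2.2] at h2; exact absurd h2.2.2 (by decide))]
  rw [← filter_or]
  refine card_le_card_of_injOn (phiU u) (fun σ hσ => ?_) (fun σ₁ _ σ₂ _ h => ?_)
  · rw [mem_coe, mem_filter] at hσ
    obtain ⟨-, hu0, hv1, ht⟩ := hσ
    unfold ctype at ht
    simp only [Prod.mk.injEq] at ht
    obtain ⟨hc0, hc1, hc2⟩ := ht
    have h0 : cnt G σ 0 = 0 := (eq_zero_iff_cap3 _).2 hc0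
    have h1 : cnt G σ 1 = 0 := (eq_zero_iff_cap3 _).2 hc1
    have h2 : cnt G σ 2 ≠ 0 := by rw [(eq_one_iff_cap3 _).2 hc2]; decide
    have hA : phiU u σ u = 0 := by rw [phiU_self, hu0]
    have hB : phiU u σ v = 1 := by rw [phiU_of_ne u σ huv.symm, hv1]; decide
    have hT1 : cap3 (cnt G (phiU u σ) 1) = 0 := (eq_zero_iff_cap3 _).1 (cnt_phiU_one G u hu0 h1)
    have hT2 : cap3 (cnt G (phiU u σ) 2) = 0 := (eq_zero_iff_cap3 _).1 (cnt_phiU_two G u hu0 h0)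
    have hT0 : cap3 (cnt G (phiU u σ) 0) ≠ 0 := fun h => cnt_phiU_zero_pos G u hu0 h2 ((eq_zero_iff_cap3 _).2 h)
    rw [mem_coe, mem_filter]
    have key : ∀ z : Fin 3, z ≠ 0 → (z, (0 : Fin 3), (0 : Fin 3)) = ((1 : Fin 3), 0, 0) ∨ (z, (0 : Fin 3), (0 : Fin 3)) = ((2 : Fin 3), 0, 0) := by
      decide
    rcases key _ hT0 with h | h
    · exact ⟨mem_univ _, Or.inl ⟨hA, hB, by unfold ctype; rw [hT1, hT2]; exact h⟩⟩
    · exact ⟨mem_univ _, Or.inr ⟨hA, hB, by unfold ctype; rw [hT1, hT2]; exact h⟩⟩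
  · have := congrArg (phiU u) h
    rwa [phiU_phiU, phiU_phiU] at this

end Swap

end Summit.CriticalPhenomena.PercolationContinuityZ3.Theorems.SunflowerPartition.Kempe
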